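import Literature.MathematicalPhysics.QuantumFieldTheory.Balaban1983to89.B15Prop1DatumSmall7AtZSequence

/-!
# `Balaban1983to89.B15Prop1Thm1GeneralFormAtZSequence` — [Balaban1989LargeFieldI] (1.74) p. 192, p. 193 ll. 14–20 ∕ [Balaban1985Variational] (1) p. 277,
# Thm 1 (7)–(8) pp. 278–279 ∕ [Balaban1988Convergent] (2.1) p. 254, (2.13) pp. 256–257, (2.18) p. 257: `Z`'S MAXIMAL SEQUENCE (2.13) AS A (2.18) INDEX
# (packaged, print's separation PROVED), and ★★★ PROPOSITION 1 [IV] AT PRINT'S (1.74) OBJECT WITH THE [15] LETTER IN CLOSED GENERAL-SEQUENCE FORM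

Honest framing: statement-level skeleton of published theorems with citation tags; proofs where landed; nothing here is a claim about
the Yang–Mills mass gap.

Cell pub-ymgap, HUMAN RULING D-0062 (Track A full width), seat `pub-ymgap-dag-n12-c` (R134 acceleration seat (a), strategy s1 of DAG node N12 = [B15];
generation g12).  `B15Prop1DatumSmall7AtZSequence` (g11) §9 leaves Proposition 1 [IV] at print's (1.74) object with ONE [15] letter PER INSTANCE, `h15Z i` = the
body of NODE 00's named fact `Node00.VariationalThm1RegSepTop7M F 2 Sup B₃ a₀ a₁` (`Node00/Record12BgRowCoClassCPM`) read at the bare sequence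
`s.Ω := maxDomT ν.M₁ (Z i)`.  NODE 00's facts cannot serve it: their binder `(s : Node00.SeqOfRecord F ν M g K k) = B14.Eq218Concrete.Seq (Node00.DOfRecord …) k`
ranges over unions of `LʲMR_j`-cubes (g10's LOCATED-GENFORM).  But r11's index type `B14.Eq218Concrete.Seq D k` and NODE 00's separation letter
`Node00.Sect2.SeqSeparated M₁ (s : Seq D k)` are ALREADY generic in the class `D`.  THIS MODULE therefore

* PACKAGES `Z`'s maximal sequence (2.13) as a (2.18) index (§3 `exists_seq_maxDomT`): an `s : Seq D k` with `s.Ω j = s.Λ j = Ω_j(Z) = maxDomT M₁ Z j` on the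
  window `1 ≤ j ≤ k` (r11's `Seq.ofChain`; `Λ_j := Ω_j`, `Ω_{j+1} ⊆ Ω_j` by `maxDomT_succ_subset`), every `s.Ω j` a union of `LʲM₁`-cubes (print's [15] (1)
  «Ω_j is a union of big blocks of the size M₁Lʲη», r11's `isUnionOfCubes_preimage_maxDomT`), and PROVES print's separation `Node00.Sect2.SeqSeparated M₁ s`
  ([6] (1.3)–(1.6) ∕ [III] p. 256 «dist(Ω_n, Ωᶜ_{n−1}) ≧ LⁿξM₁», NODE 00's reading: one layer of `L^{n+1}M₁`-cubes around `Ω_{n+1}` inside `Ω_n`) from r11's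
  `dist_maxDom` on the universal cover (§2 `enl_maxDom_succ_subset_maxDom`: a point of an `s_{n+1}`-cube ADJACENT to a cube of `Ω_{n+1}(Z)` is clamped to within
  `s_{n+1} − 1` of that cube except at the two extreme coordinates `s_{n+1}c − s_{n+1}`, `s_{n+1}c + 2s_{n+1} − 1`, where it moves by one site INSIDE its own
  `s_n`-cube (`s_n = LⁿM₁ ≥ 2`, `s_n ∣ s_{n+1}`); `Ω_n(Z)` is a union of `s_n`-cubes, `isUnionOfCubes_maxDom_succ`);
* proves the WINDOW CONGRUENCE of the [15]-body readers (§1): `genSet`, `Node00.regMSCoPOfRecord(At)`, `Node00.Sect2.printedPlaqsTop` read a sequence only on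
  `1 ≤ j ≤ k` (`k ≥ 1`), so the (1.74) objects of record at `maxDomT ν.M₁ Z` ARE the objects at the index `s` (the off-window values `s.Ω 0 = s.Ω (k+1) = ∅` of a
  (2.18) index are never read — [15] (1) «Ω_{k+1} = ∅»; the level-`k` (7) range of the index is ALL `k`-plaquettes meeting `Ω_k(Z)^{(k)}`, inside `Z^{(k)}` by
  §5 `plaqsOf_pts_maxDomT_subset_plaqsInside`, the strong form of g11's §8);
* DERIVES the k-block letter (Gᵃ) `IsBlockUnion k Z` of g11 from print's cube letter «Z a union of M-cubes of T₁^{(k)}», read `IsUnionOfCubes (LᵏM₁) (π⁻¹Z)` on the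
  cover (§4, r11's `B14.Eq213DetSet.cubeIdx_lift_blockRep`);
* hence ★★★ §6 `nearValue_letter_of_thm1General` and ★★★ §7 `exists_domain_prop1Printed_lfVarOn_std_su2_box_intrinsic_analytic_atZSeqCoPRecord_ofThm1General`:
  g11's §9 endpoints with the per-instance letters `h15Z i` REPLACED by ONE CLOSED, INSTANCE-INDEPENDENT letter `h15D` — the text of
  `Node00.VariationalThm1RegSepTop7M F 2 (fun ν K Ω => Node00.suppDomOfRecord F ν K Ω) B₃ a₀ a₁` (= `Node00.VariationalThm1RegSepCoP7M F 2 B₃ a₀ a₁`) after its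
  sequence binder, with `(M g) (s : SeqOfRecord F ν M g K k)` generalised to `(D) (s : Seq D k)` plus print's cube letter [15] (1) on `s.Ω`, at the numerics `ν`
  and torus `Kt` of the consumer — i.e. NODE 00's own «TODO(general form): general admissible {Ω_j}» of that fact, stated as a HYPOTHESIS BINDER (no `def … : Prop`
  here; naming it is NODE 00's [15]-leaf pen, and the named fact serves `h15D` by ONE application); (Gᵃ) `hZblk` is kept (§4 derives it from print's cube letter).

LOCATED (self-audit of the lineage, recorded): the [15]-body reads a sequence `Ω` OFF the window `1 ≤ j ≤ k` in exactly one place — the level-`k` clause of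
print's (7) (`Node00.Sect2.printedPlaqs Ω k k` cuts by «no bond inside `Ω_{k+1}`», `Node00.Sect2.plaqNoBondIn Ω k`).  For a (2.18) index `s.Ω (k+1) = ∅` ([15] (1)
«Ω_{k+1} = ∅»), so the level-`k` range is ALL `k`-plaquettes meeting `Ω_k^{(k)}`; g11's per-instance letter `h15Z` (p549235 §5∕§9) reads the UNTRUNCATED sequence
`maxDomT ν.M₁ Z`, whose `Ω_{k+1}(Z) ≠ ∅` cuts that range, so its (7) hypothesis is WEAKER and `h15Z` is (slightly) STRONGER than the instance of the general-form
fact at `Z`'s index — not served by one application of it.  `h15D` below IS that general form; the proof here re-derives (7) for the (1.74) datum along the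
index itself (§5 supplies the full level-`k` range inside `Z^{(k)}`), so nothing is lost.

LETTERS after this module, per instance of Proposition 1 at print's (1.74) object: (J1) `hGj`, (L2) `hlead`+`hsm`∕`hγle` ([15] Thm 1 ∕ Prop. 9; [LF-II] pp. 357–358
— NODE 00's), `hfar` (n12-d: `far_letter_of_box`), (Gᵃ) `hZblk : IsBlockUnion k Z` (unchanged; §4 derives it from print's cube letter `IsUnionOfCubes (LᵏM₁) (π⁻¹ Z)`,
[IV] (1.70)–(1.73): `Z` a union of `M`-cubes of `T₁^{(k)}`, `M` a multiple of `M₁`), `2 ≤ M₁`, `LᵏM₁ ∣ 2L^{m+K}`, bookkeeping (`hcE`, `heRa`, `hB₃`, `hcA`,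
`ha₀ : εreg ≤ a₀`, `hcJ'`), structure, and the ONE closed letter `h15D`.  Non-vacuity of the cube letter at `Z = T_η`: §8.

CONTENTS.  §1 `gammaRegion_congr`, `genSet_congr`, `plaqNoBondIn_congr`, `printedPlaqsTop_congr`, `regMSCoPOfRecordAt_congr`, `regMSCoPOfRecord_congr`.
§2 ★ `enl_maxDom_succ_subset_maxDom` (ℤᵈ).  §3 `enlT_maxDomT_succ_subset`, ★★ `exists_seq_maxDomT`, `exists_seq_maxDomT_cubeClass`.  §4 `isBlockUnion_of_isUnionOfCubes_cover`.
§5 ★ `plaqsOf_pts_maxDomT_subset_plaqsInside` (+ 1 private `Within` lemma).  §6 ★★★ `nearValue_letter_of_thm1General`.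
§7 ★★★ `exists_domain_prop1Printed_lfVarOn_std_su2_box_intrinsic_analytic_atZSeqCoPRecord_ofThm1General`.  §8 `isUnionOfCubes_preimage_univ`.
No `def`, no `instance`, no `sorry`; axioms standard.

HONEST SCOPE.  Count-neutral lattice geometry and binder surgery: nothing of Bałaban asserted; the [15] letter is DISPLAYED (closed form), not discharged; (J1)∕(L2)
remain NODE 00's; NOT a discharge of N12; nothing continuum ∕ OS ∕ mass-gap ∕ Clay.

## References
* [Balaban1989LargeFieldI] T. Bałaban, Commun. Math. Phys. 122 (1989) 175–202, (1.74) p. 192, p. 193, Prop. 1 p. 194.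
* [Balaban1985Variational] T. Bałaban, Commun. Math. Phys. 102 (1985) 277–309, (1) p. 277, Thm 1 (2)–(8) pp. 278–279.
* [Balaban1985RegularSpaces] T. Bałaban, Commun. Math. Phys. 99 (1985) 75–102, (1.3)–(1.9) p. 77.
* [Balaban1988Convergent] T. Bałaban, Commun. Math. Phys. 119 (1988) 243–285, (2.1)–(2.2) pp. 254–255, (2.12)–(2.13) pp. 256–257, (2.18) p. 257.
* [Balaban1989LargeFieldII] T. Bałaban, Commun. Math. Phys. 122 (1989) 355–392, (1.7)–(1.13) pp. 358–359.
-/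

noncomputable section

open Set

namespace Literature.MathematicalPhysics.QuantumFieldTheory.Balaban1983to89.B15Prop1Thm1GeneralFormAtZSequence

open T4Continuum B15DeterminingSets GaugeField B15Prop1Carrier B8Eq17ClassAkV1 BlockAveraging
open B14.Eq22Determines (blockIter IsBlockUnion)
open Literature.MathematicalPhysics.QuantumFieldTheory.BalabanImbrieJaffe1984to88.BIJ85Eq453GaugeField (qsstarGIter0)
open B15Prop1DatumSmall7AtZSequence

/-! ## §1 Window congruence: the [15]-body readers read a sequence only on `1 ≤ j ≤ k` -/

section Congr

variable {P : Params}

/-- The determining-set regions `Γ_i` of [III] (2.2) read the sequence only on the window `1 ≤ j ≤ k` (`k ≥ 1`; `Γ₀ = Ω₁ᶜ`).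
[cite: Balaban1988Convergent, (2.2) p.255 (bookkeeping)] -/
theorem gammaRegion_congr {Ω Ω' : ℕ → Set (Site P 0)} {k : ℕ} (hk : 1 ≤ k) (h : ∀ j, 1 ≤ j → j ≤ k → Ω j = Ω' j) (i : ℕ) :
    gammaRegion Ω k i = gammaRegion Ω' k i := by
  unfold gammaRegion
  by_cases h1 : k < i
  · simp only [if_pos h1]
  by_cases h2 : i = k
  · simp only [if_neg h1, if_pos h2, h k hk le_rfl]
  by_cases h3 : i = 0
  · simp only [if_neg h1, if_neg h2, if_pos h3, h 1 le_rfl hk]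
  simp only [if_neg h1, if_neg h2, if_neg h3, h i (Nat.one_le_iff_ne_zero.mpr h3) (by omega), h (i + 1) (by omega) (by omega)]

/-- The determining set `𝐁 = {Γ_j}` of [III] (2.2) reads the sequence only on the window `1 ≤ j ≤ k` (`k ≥ 1`).
[cite: Balaban1988Convergent, (2.2) p.255 (bookkeeping)] -/
theorem genSet_congr {Ω Ω' : ℕ → Set (Site P 0)} {k : ℕ} (hk : 1 ≤ k) (h : ∀ j, 1 ≤ j → j ≤ k → Ω j = Ω' j) :
    genSet Ω k = genSet Ω' k := by
  funext i
  show pts i (gammaRegion Ω k i) = pts i (gammaRegion Ω' k i)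
  rw [gammaRegion_congr hk h i]

/-- NODE 00's «no bond inside `Ω_{n+1}`» cut of the (7) range reads only `Ω_{n+1}`. [cite: Balaban1985Variational, (7) p.278 (bookkeeping)] -/
theorem plaqNoBondIn_congr {Ω Ω' : ℕ → Set (Site P 0)} {n : ℕ} (h : Ω (n + 1) = Ω' (n + 1)) :
    Node00.Sect2.plaqNoBondIn Ω n = Node00.Sect2.plaqNoBondIn Ω' n := by
  unfold Node00.Sect2.plaqNoBondIn
  rw [h]

/-- NODE 00's level-`0` (7) range for a top domain reads the sequence only on the window (`k ≥ 1`: `Γ₀ = Ω₁ᶜ`, no bond inside `Ω₁`).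
[cite: Balaban1985Variational, (3),(7) p.278 (bookkeeping)] -/
theorem printedPlaqsTop_congr {Ω Ω' : ℕ → Set (Site P 0)} {k : ℕ} (hk : 1 ≤ k) (h : ∀ j, 1 ≤ j → j ≤ k → Ω j = Ω' j)
    (Ω₀ : Set (Site P 0)) : Node00.Sect2.printedPlaqsTop Ω Ω₀ k = Node00.Sect2.printedPlaqsTop Ω' Ω₀ k := by
  unfold Node00.Sect2.printedPlaqsTop Node00.Sect2.printedPlaqs
  rw [genSet_congr hk h, plaqNoBondIn_congr (n := 0) (h 1 le_rfl hk)]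

/-- NODE 00's class (2) on a support reads the sequence only on the window `1 ≤ j ≤ k` (scale `0` is the support).
[cite: Balaban1985Variational, (2) p.278 (bookkeeping); Balaban1988Convergent, (2.12) p.256] -/
theorem regMSCoPOfRecordAt_congr (F : T4Family) (N : ℕ) [NeZero N] (ν : Node00.Stage7Numerics) (K k : ℕ) (Ω₀ : Set (Site (F.P K) 0))
    {Ω Ω' : ℕ → Set (Site (F.P K) 0)} (h : ∀ j, 1 ≤ j → j ≤ k → Ω j = Ω' j) :
    Node00.regMSCoPOfRecordAt F N ν K k Ω₀ Ω = Node00.regMSCoPOfRecordAt F N ν K k Ω₀ Ω' := by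
  have ht : ∀ j, j ≤ k → Node00.topSeq Ω₀ Ω j = Node00.topSeq Ω₀ Ω' j := fun j hj => by
    rcases Nat.eq_zero_or_pos j with rfl | hj0
    · rfl
    · rw [Node00.topSeq_of_ne_zero _ _ hj0.ne', Node00.topSeq_of_ne_zero _ _ hj0.ne', h j hj0 hj]
  ext U
  simp only [Node00.mem_regMSCoPOfRecordAt_iff]
  constructor
  · rintro ⟨ha, hb⟩
    exact ⟨fun j hj => by rw [← ht j hj]; exact ha j hj, fun j hj => by rw [← ht j hj]; exact hb j hj⟩
  · rintro ⟨ha, hb⟩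
    exact ⟨fun j hj => by rw [ht j hj]; exact ha j hj, fun j hj => by rw [ht j hj]; exact hb j hj⟩

/-- NODE 00's class of record (support `Ω₁ +` one layer of `M₁`-cubes) reads the sequence only on the window `1 ≤ j ≤ k` (`k ≥ 1`).
[cite: Balaban1985Variational, (2) p.278 (bookkeeping); Balaban1988Convergent, p.255, (2.12) p.256] -/
theorem regMSCoPOfRecord_congr (F : T4Family) (N : ℕ) [NeZero N] (ν : Node00.Stage7Numerics) (K : ℕ) {k : ℕ} (hk : 1 ≤ k)
    {Ω Ω' : ℕ → Set (Site (F.P K) 0)} (h : ∀ j, 1 ≤ j → j ≤ k → Ω j = Ω' j) :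
    Node00.regMSCoPOfRecord F N ν K k Ω = Node00.regMSCoPOfRecord F N ν K k Ω' := by
  unfold Node00.regMSCoPOfRecord
  rw [Node00.suppDomOfRecord_congr (F := F) ν K (h 1 le_rfl hk)]
  exact regMSCoPOfRecordAt_congr F N ν K k _ h

end Congr

/-! ## §2 Print's separation for the maximal sequence on `ℤᵈ`: one layer of `s_{n+1}`-cubes around `Ω_{n+1}` lies in `Ω_n` (`n ≥ 1`) -/

section CoverSeparation

open B14DomainGeom
open B14.Eq213MaximalDomains

variable {d : ℕ}

/-- ★ **«dist(Ω_{n+1}, Ωᶜ_n) ≧ L^{n+1}ξM₁» IN THE CUBE-LAYER READING, for r11's maximal sequence on `ℤᵈ`** ([III] p. 256; [6] (1.3)–(1.6)): for `n ≥ 1`,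
`L ≥ 2`, `M₁ ≥ 1`, every `s_{n+1}`-cube adjacent (corners included) to a cube of `Ω_{n+1}` lies in `Ω_n` — `enl s_{n+1} 1 Ω_{n+1} ⊆ Ω_n`.  PROOF: a point `x` of
an adjacent cube is clamped to a point `z` within `s_{n+1} − 1` of the cube (so `z ∈ Ω_n` by r11's `dist_maxDom`); `z = x` except at the two extreme
coordinate values, where `z` moves by one site INSIDE the `s_n`-cube of `x` (`s_n = LⁿM₁ ≥ 2` divides `s_{n+1}`), and `Ω_n` is a union of `s_n`-cubes
(`isUnionOfCubes_maxDom_succ`). [cite: Balaban1988Convergent, (2.13) pp.256–257; Balaban1985RegularSpaces, (1.3)–(1.6) p.77] -/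
theorem enl_maxDom_succ_subset_maxDom {L M₁ : ℕ} (hL : 2 ≤ L) (hM : 1 ≤ M₁) (Ω : Set (Pt d)) {n : ℕ} (hn : 1 ≤ n) :
    enl (side L M₁ (n + 1)) 1 (maxDom L M₁ Ω (n + 1)) ⊆ maxDom L M₁ Ω n := by
  obtain ⟨m, rfl⟩ : ∃ m, n = m + 1 := ⟨n - 1, by omega⟩
  rintro x ⟨y, hy, hnear⟩
  have hL1 : 1 ≤ L := le_trans one_le_two hL
  have hs'pos : 0 < side L M₁ (m + 1) := side_pos hL1 hM _
  have hspos : 0 < side L M₁ (m + 1 + 1) := side_pos hL1 hM _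
  -- notation: `S` the big side, `S'` the small side, `c` the big-cube index of `y`
  set S : ℤ := (side L M₁ (m + 1 + 1) : ℤ) with hSdef
  set S' : ℤ := (side L M₁ (m + 1) : ℤ) with hS'def
  have hSS' : S = (L : ℤ) * S' := by rw [hSdef, hS'def, side_succ]; push_cast; ring
  have hS'2 : 2 ≤ S' := by
    have h2 : 2 ≤ side L M₁ (m + 1) := by
      unfold side
      calc 2 ≤ L := hL
        _ = L ^ 1 * 1 := by ring
        _ ≤ L ^ (m + 1) * M₁ := Nat.mul_le_mul (Nat.pow_le_pow_right hL1 (by omega)) hM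
    rw [hS'def]; exact_mod_cast h2
  have hS'pos : 0 < S' := by linarith
  have hL2 : (2 : ℤ) ≤ L := by exact_mod_cast hL
  have hS2 : 2 * S' ≤ S := by rw [hSS']; exact mul_le_mul_of_nonneg_right hL2 hS'pos.le
  have hS4 : 4 ≤ S := by linarith
  set c : Pt d := cubeIdx (side L M₁ (m + 1 + 1)) y with hcdef
  -- bounds on `x` from the adjacency of its big cube to the big cube of `y`
  have hxb : ∀ i, S * c i - S ≤ x i ∧ x i ≤ S * c i + 2 * S - 1 := by
    intro i
    have h1 := cubeIdx_le (side L M₁ (m + 1 + 1)) hspos x i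
    have h2 := lt_cubeIdx (side L M₁ (m + 1 + 1)) hspos x i
    have h3 := hnear i
    rw [← hcdef, Nat.cast_one, abs_le] at h3
    rw [← hSdef] at h1 h2
    have hS0 : (0 : ℤ) ≤ S := by linarith
    constructor
    · have : S * (c i - 1) ≤ S * cubeIdx (side L M₁ (m + 1 + 1)) x i := mul_le_mul_of_nonneg_left (by linarith) hS0
      linarith
    · have : S * cubeIdx (side L M₁ (m + 1 + 1)) x i ≤ S * (c i + 1) := mul_le_mul_of_nonneg_left (by linarith) hS0
      linarith
  -- the clamped points: `x'` in the big cube of `y`, `z` in its `(S−1)`-collar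
  set x' : Pt d := fun i => max (S * c i) (min (x i) (S * c i + S - 1)) with hx'def
  set z : Pt d := fun i => max (S * c i - S + 1) (min (x i) (S * c i + 2 * S - 2)) with hzdef
  have hx'c : cubeIdx (side L M₁ (m + 1 + 1)) x' = c := by
    refine cubeIdx_eq_of_mem _ hspos x' c fun i => ?_
    rw [← hSdef]
    show S * c i ≤ max (S * c i) (min (x i) (S * c i + S - 1)) ∧ max (S * c i) (min (x i) (S * c i + S - 1)) < S * c i + S
    constructor
    · exact le_max_left _ _
    · rcases le_total (S * c i) (min (x i) (S * c i + S - 1)) with hle | hle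
      · rw [max_eq_right hle]; have := min_le_right (x i) (S * c i + S - 1); linarith
      · rw [max_eq_left hle]; linarith
  have hw : Within ((side L M₁ (m + 1 + 1) : ℤ) - 1) x' z := by
    intro i
    rw [← hSdef]
    obtain ⟨hl, hu⟩ := hxb i
    show |max (S * c i) (min (x i) (S * c i + S - 1)) - max (S * c i - S + 1) (min (x i) (S * c i + 2 * S - 2))| ≤ S - 1
    rw [abs_le]
    rcases le_or_gt (x i) (S * c i - 1) with hA | hA
    · rw [min_eq_left (show x i ≤ S * c i + S - 1 by linarith), max_eq_left (show x i ≤ S * c i by linarith),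
        min_eq_left (show x i ≤ S * c i + 2 * S - 2 by linarith)]
      have e1 : max (S * c i - S + 1) (x i) ≤ S * c i - 1 := max_le (by linarith) hA
      have e2 : S * c i - S + 1 ≤ max (S * c i - S + 1) (x i) := le_max_left _ _
      constructor <;> linarith
    · rcases le_or_gt (x i) (S * c i + S - 1) with hB | hB
      · rw [min_eq_left hB, max_eq_right (show S * c i ≤ x i by linarith),
          min_eq_left (show x i ≤ S * c i + 2 * S - 2 by linarith), max_eq_right (show S * c i - S + 1 ≤ x i by linarith)]
        constructor <;> linarith
      · rw [min_eq_right (show S * c i + S - 1 ≤ x i by linarith), max_eq_right (show S * c i ≤ S * c i + S - 1 by linarith),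
          max_eq_right (show S * c i - S + 1 ≤ min (x i) (S * c i + 2 * S - 2) from le_min (by linarith) (by linarith))]
        have e1 : min (x i) (S * c i + 2 * S - 2) ≤ S * c i + 2 * S - 2 := min_le_right _ _
        have e2 : S * c i + S ≤ min (x i) (S * c i + 2 * S - 2) := le_min (by linarith) (by linarith)
        constructor <;> linarith
  -- `z ∈ Ω_{m+1}` by the maximal-sequence constraint at `y ∈ Ω_{m+2}`
  have hz : z ∈ maxDom L M₁ Ω (m + 1) := (mem_maxDom_succ L M₁ Ω (m + 1) y).1 hy x' (by rw [hx'c]) z hw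
  -- `x` and `z` lie in the same small cube
  have hidx : cubeIdx (side L M₁ (m + 1)) z = cubeIdx (side L M₁ (m + 1)) x := by
    refine cubeIdx_eq_of_mem _ hs'pos z _ fun i => ?_
    rw [← hS'def]
    have h1 := cubeIdx_le (side L M₁ (m + 1)) hs'pos x i
    have h2 := lt_cubeIdx (side L M₁ (m + 1)) hs'pos x i
    rw [← hS'def] at h1 h2
    obtain ⟨hl, hu⟩ := hxb i
    set q : ℤ := cubeIdx (side L M₁ (m + 1)) x i with hqdef
    show S' * q ≤ max (S * c i - S + 1) (min (x i) (S * c i + 2 * S - 2)) ∧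
      max (S * c i - S + 1) (min (x i) (S * c i + 2 * S - 2)) < S' * q + S'
    rcases le_or_gt (S * c i - S + 1) (x i) with hlo' | hlo'
    · rcases le_or_gt (x i) (S * c i + 2 * S - 2) with hhi' | hhi'
      · -- `z i = x i`
        rw [min_eq_left hhi', max_eq_right hlo']
        exact ⟨h1, h2⟩
      · -- `x i = S c + 2S − 1`, `z i = x i − 1`; `S' ∣ x i + 1` forbids `x i = S' q`
        have hxi : x i = S * c i + 2 * S - 1 := by linarith
        rw [min_eq_right (by linarith), max_eq_right (by linarith)]
        refine ⟨?_, by linarith⟩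
        by_contra hcon
        have hxq : x i = S' * q := by linarith
        have hdvd : S' ∣ x i + 1 := ⟨(L : ℤ) * (c i + 2), by rw [hxi, hSS']; ring⟩
        have hdvd1 : S' ∣ 1 := by
          have e : x i + 1 - S' * q = 1 := by rw [hxq]; ring
          rw [← e]
          exact dvd_sub hdvd (dvd_mul_right _ _)
        have : S' ≤ 1 := Int.le_of_dvd one_pos hdvd1
        linarith
    · -- `x i = S c − S`, `z i = x i + 1`; `S' ∣ x i` forces `x i = S' q`
      have hxi : x i = S * c i - S := by linarith
      rw [min_eq_left (by linarith), max_eq_left (by linarith)]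
      refine ⟨by linarith, ?_⟩
      have hdvd : S' ∣ x i := ⟨(L : ℤ) * (c i - 1), by rw [hxi, hSS']; ring⟩
      have hxq : x i = S' * q := by
        obtain ⟨r, hr⟩ := hdvd
        have h3 : q ≤ r := by
          by_contra h
          have h' : r ≤ q - 1 := by omega
          have : S' * r ≤ S' * (q - 1) := mul_le_mul_of_nonneg_left h' hS'pos.le
          linarith
        have h4 : r ≤ q := by
          by_contra h
          have h' : q + 1 ≤ r := by omega
          have : S' * (q + 1) ≤ S' * r := mul_le_mul_of_nonneg_left h' hS'pos.le
          linarith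
        rw [hr, le_antisymm h4 h3]
      linarith
  exact (isUnionOfCubes_maxDom_succ L M₁ Ω m x z hidx.symm).mpr hz

end CoverSeparation

/-! ## §3 `Z`'s maximal sequence (2.13) as a (2.18) index, with print's separation -/

section ZSeq

open B15Eq112TorusCover (cover lift cover_lift)
open B14DomainGeom (Pt Within IsUnionOfCubes enl)
open B14.Eq213MaximalDomains (side isUnionOfCubes_maxDom_succ)
open B14.Eq213DetSet (maxDomT maxDomT_zero maxDomT_subset maxDomT_succ_subset dist_maxDomT preimage_maxDomT)

variable {P : Params}

/-- `2 ≤ L` for the `Setup` parameters (`L` odd, `L > 1`). [folklore] -/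
private theorem two_le_L (P : Params) : 2 ≤ P.L := P.hL.2

/-- ★ **PRINT'S SEPARATION FOR `Z`'S MAXIMAL SEQUENCE ON THE TORUS**, in NODE 00's reading (`Node00.Sect2.enlT`: one layer of `L^{n+1}M₁`-cubes around `Ω_{n+1}(Z)`
lies in `Ω_n(Z)`, `1 ≤ n < k`; divisibility `LᵏM₁ ∣ 2L^{m+K}` of the cube partitions) — §2 read through the universal cover (r11's `preimage_maxDomT`).
[cite: Balaban1988Convergent, (2.13) pp.256–257; Balaban1985RegularSpaces, (1.3)–(1.6) p.77] -/
theorem enlT_maxDomT_succ_subset {M₁ : ℕ} (hM : 1 ≤ M₁) {Z : Set (Site P 0)} {k : ℕ} (hdiv : side P.L M₁ k ∣ P.sitesPerDir 0)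
    {n : ℕ} (hn : 1 ≤ n) (hnk : n < k) :
    Node00.Sect2.enlT P (side P.L M₁ (n + 1)) 1 (maxDomT M₁ Z (n + 1)) ⊆ maxDomT M₁ Z n := by
  rintro _ ⟨x, hx, rfl⟩
  rw [preimage_maxDomT hM hdiv (Nat.succ_le_of_lt hnk)] at hx
  have hx' := enl_maxDom_succ_subset_maxDom (two_le_L P) hM (cover P ⁻¹' Z) hn hx
  rw [← preimage_maxDomT hM hdiv hnk.le] at hx'
  exact hx'

/-- ★★ **`Z`'S MAXIMAL SEQUENCE (2.13) IS A SEPARATED (2.18) INDEX OVER PRINT'S CLASS** ([III] (2.1), (2.13), (2.18); [15] (1) p. 277 «Ω_j ⊂ T_η, Ω₀ ⊃ Ω₁ ⊃ ⋯ ⊃ Ω_k,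
Ω_j is a union of big block of the size M₁Lʲη»): for ANY region `Z ⊆ T_η`, `M₁ ≥ 1` and `LᵏM₁ ∣ 2L^{m+K}`, there is an r11 index `s : Seq D k` (`D` the trivial
class; `Λ_j := Ω_j`) with `s.Ω j = s.Λ j = Ω_j(Z)` on `1 ≤ j ≤ k`, every `s.Ω j` a union of `LʲM₁`-cubes (by construction of the maximal sequence, r11's
`isUnionOfCubes_maxDom_succ` read on the cover), and NODE 00's separation `Node00.Sect2.SeqSeparated M₁ s`.
[cite: Balaban1988Convergent, (2.1) p.254, (2.13) pp.256–257, (2.18) p.257; Balaban1985Variational, (1) p.277; Balaban1985RegularSpaces, (1.3)–(1.6) p.77] -/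
theorem exists_seq_maxDomT {M₁ : ℕ} (hM : 1 ≤ M₁) (Z : Set (Site P 0)) {k : ℕ} (hdiv : side P.L M₁ k ∣ P.sitesPerDir 0) :
    ∃ s : B14.Eq218Concrete.Seq (fun _ : ℕ => (Set.univ : Set (Set (Site P 0)))) k,
      (∀ j, 1 ≤ j → j ≤ k → s.Ω j = maxDomT M₁ Z j) ∧ (∀ j, 1 ≤ j → j ≤ k → s.Λ j = maxDomT M₁ Z j) ∧
      (∀ j, 1 ≤ j → j ≤ k → IsUnionOfCubes (side P.L M₁ j) (cover P ⁻¹' s.Ω j)) ∧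
      Node00.Sect2.SeqSeparated M₁ s := by
  have hchain : B14.Eq218Concrete.Chain21 (fun _ : ℕ => (Set.univ : Set (Set (Site P 0)))) k (maxDomT M₁ Z) (maxDomT M₁ Z) :=
    { memΩ := fun _ _ _ => Set.mem_univ _
      memΛ := fun _ _ _ => Set.mem_univ _
      Λ_subset := fun _ _ _ => subset_rfl
      Ω_succ_subset := fun j _ _ => maxDomT_succ_subset hM Z j }
  refine ⟨B14.Eq218Concrete.Seq.ofChain _ _ hchain, fun j h1 hj => B14.Eq218Concrete.Seq.ofChain_Ω hchain h1 hj,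
    fun j h1 hj => B14.Eq218Concrete.Seq.ofChain_Λ hchain h1 hj, fun j h1 hj => ?_, ?_⟩
  · obtain ⟨n, rfl⟩ : ∃ n, j = n + 1 := ⟨j - 1, by omega⟩
    rw [B14.Eq218Concrete.Seq.ofChain_Ω hchain h1 hj, preimage_maxDomT hM hdiv hj]
    exact isUnionOfCubes_maxDom_succ P.L M₁ _ n
  · intro n hn hnk
    rw [B14.Eq218Concrete.Seq.ofChain_Ω hchain (by omega) (Nat.succ_le_of_lt hnk), B14.Eq218Concrete.Seq.ofChain_Ω hchain hn hnk.le]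
    exact enlT_maxDomT_succ_subset hM hdiv hn hnk

/-- **THE SAME INDEX OVER PRINT'S CLASS [15] (1) ITSELF** — `D_{M₁} n = {S | S a union of LⁿM₁-cubes of T_η}` (cover reading): `Z`'s maximal sequence packaged as
`s : Seq D_{M₁} k` (both `s.Ω j` and `s.Λ j = Ω_j(Z)` members), separated.  For a NODE 00 general-form fact quantified over this class rather than over all `D`.
[cite: Balaban1985Variational, (1) p.277; Balaban1988Convergent, (2.1) p.254, (2.13) pp.256–257, (2.18) p.257; Balaban1985RegularSpaces, (1.3)–(1.6) p.77] -/
theorem exists_seq_maxDomT_cubeClass {M₁ : ℕ} (hM : 1 ≤ M₁) (Z : Set (Site P 0)) {k : ℕ} (hdiv : side P.L M₁ k ∣ P.sitesPerDir 0) :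
    ∃ s : B14.Eq218Concrete.Seq (fun n : ℕ => {S : Set (Site P 0) | IsUnionOfCubes (side P.L M₁ n) (cover P ⁻¹' S)}) k,
      (∀ j, 1 ≤ j → j ≤ k → s.Ω j = maxDomT M₁ Z j) ∧ (∀ j, 1 ≤ j → j ≤ k → s.Λ j = maxDomT M₁ Z j) ∧
      Node00.Sect2.SeqSeparated M₁ s := by
  have hmem : ∀ j, 1 ≤ j → j ≤ k →
      maxDomT M₁ Z j ∈ ({S : Set (Site P 0) | IsUnionOfCubes (side P.L M₁ j) (cover P ⁻¹' S)} : Set (Set (Site P 0))) := by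
    intro j h1 hj
    obtain ⟨n, rfl⟩ : ∃ n, j = n + 1 := ⟨j - 1, by omega⟩
    show IsUnionOfCubes (side P.L M₁ (n + 1)) (cover P ⁻¹' maxDomT M₁ Z (n + 1))
    rw [preimage_maxDomT hM hdiv hj]
    exact isUnionOfCubes_maxDom_succ P.L M₁ _ n
  have hchain : B14.Eq218Concrete.Chain21 (fun n : ℕ => {S : Set (Site P 0) | IsUnionOfCubes (side P.L M₁ n) (cover P ⁻¹' S)}) k
      (maxDomT M₁ Z) (maxDomT M₁ Z) :=
    { memΩ := fun j h1 hj => hmem j h1 hj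
      memΛ := fun j h1 hj => hmem j h1 hj
      Λ_subset := fun _ _ _ => subset_rfl
      Ω_succ_subset := fun j _ _ => maxDomT_succ_subset hM Z j }
  refine ⟨B14.Eq218Concrete.Seq.ofChain _ _ hchain, fun j h1 hj => B14.Eq218Concrete.Seq.ofChain_Ω hchain h1 hj,
    fun j h1 hj => B14.Eq218Concrete.Seq.ofChain_Λ hchain h1 hj, ?_⟩
  intro n hn hnk
  rw [B14.Eq218Concrete.Seq.ofChain_Ω hchain (by omega) (Nat.succ_le_of_lt hnk), B14.Eq218Concrete.Seq.ofChain_Ω hchain hn hnk.le]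
  exact enlT_maxDomT_succ_subset hM hdiv hn hnk

end ZSeq

/-! ## §4 (Gᵃ) from print's cube letter: a union of `LᵏM₁`-cubes (cover reading) is a union of `k`-blocks -/

section BlockUnion

open B15Eq112TorusCover (cover lift cover_lift)
open B14DomainGeom (IsUnionOfCubes)
open B14.Eq213DetSet (cubeIdx_lift_blockRep)

variable {P : Params}

/-- **A UNION OF CUBES OF SIDE `s`, `Lᵏ ∣ s` (cover reading), IS A UNION OF `k`-BLOCKS** (`k ≤ m + K`): the standard lifts of a fine site and of the representative
point of its `k`-block lie in the same `s`-cube (r11's `cubeIdx_lift_blockRep`).  Print: `Z` is a union of `M`-cubes of `T₁^{(k)}`, hence of `k`-blocks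
([IV] (1.70)–(1.73)). [cite: Balaban1989LargeFieldI, (1.70)–(1.73) pp.191–192; Balaban1987RG1, (0.1) p.251] -/
theorem isBlockUnion_of_isUnionOfCubes_cover {k s : ℕ} (hk : k ≤ P.m + P.K) (hs : P.L ^ k ∣ s) {Z : Set (Site P 0)}
    (hZ : IsUnionOfCubes s (cover P ⁻¹' Z)) : IsBlockUnion k Z := by
  intro x
  have h := hZ (lift P (embIter k (blockIter k x))) (lift P x) (cubeIdx_lift_blockRep hk hs x)
  simp only [Set.mem_preimage, cover_lift] at h
  exact h.symm

end BlockUnion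

/-! ## §5 The level-`j` plaquettes meeting `Ω_j(Z)^{(j)}` lie inside `Z^{(j)}` (strong form of g11's §8, levels `j ≥ 1`) -/

section ZRangesStrong

open B15Eq112TorusCover (cover lift per cover_apply cover_lift cover_eq_cover_iff cover_add_pmul)
open B14DomainGeom (Pt Within)
open B14.Eq213MaximalDomains (side cubeExt)
open B14.Eq213DetSet (maxDomT maxDomT_zero maxDomT_subset dist_maxDomT)

variable {P : Params}

/-- Sup-distance `≤ t` between any two corners `x + a e_μ + b e_ν`, `a, b ∈ {0, t}`, `μ ≠ ν`. [folklore] -/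
private theorem within_corner {d : ℕ} (x : Pt d) {μ ν : Fin d} (hne : μ ≠ ν) {t : ℤ} (ht : 0 ≤ t) {a b a' b' : ℤ}
    (ha : a = 0 ∨ a = t) (hb : b = 0 ∨ b = t) (ha' : a' = 0 ∨ a' = t) (hb' : b' = 0 ∨ b' = t) :
    Within t (x + Pi.single μ a + Pi.single ν b) (x + Pi.single μ a' + Pi.single ν b') := by
  intro i
  simp only [Pi.add_apply]
  rw [abs_le]
  by_cases hμ : i = μ
  · subst hμ
    rw [Pi.single_eq_same, Pi.single_eq_same, Pi.single_eq_of_ne hne, Pi.single_eq_of_ne hne]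
    rcases ha with ha | ha <;> rcases ha' with ha' | ha' <;> constructor <;> linarith
  · by_cases hν : i = ν
    · subst hν
      rw [Pi.single_eq_same, Pi.single_eq_same, Pi.single_eq_of_ne hμ, Pi.single_eq_of_ne hμ]
      rcases hb with hb | hb <;> rcases hb' with hb' | hb' <;> constructor <;> linarith
    · rw [Pi.single_eq_of_ne hμ, Pi.single_eq_of_ne hμ, Pi.single_eq_of_ne hν, Pi.single_eq_of_ne hν]
      constructor <;> linarith

/-- ★ **ALL LEVEL-`j` PLAQUETTES MEETING `Ω_j(Z)^{(j)}` LIE INSIDE `Z^{(j)}`** (`1 ≤ j ≤ J`, `M₁ ≥ 2`, `LᴶM₁ ∣ 2L^{m+K}`) — the strong form of g11's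
`printedPlaqs_maxDomT_subset_plaqsInside` (no «no bond inside `Ω_{j+1}`» cut; it is the level-`k` (7) range of a (2.18) index, [15] (1) «Ω_{k+1} = ∅»): a scale-`j`
plaquette touching `Ω_j(Z)^{(j)}` has all four centres within sup-distance `L^j ≤ LʲM₁ − 1` of a centre in `Ω_j(Z)`, hence in `Ω_{j−1}(Z) ⊆ Z` by *«dist(Ω_n, Ωᶜ_{n−1}) ≧ LⁿξM₁»*
(r11's `dist_maxDomT`).  Proof adapted from g11's §8 (same cover bookkeeping: `cover_add_single_pow`).
[cite: Balaban1988Convergent, (2.13) pp.256–257, (2.2) p.255; Balaban1985Variational, (1) p.277, (7) p.278] -/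
theorem plaqsOf_pts_maxDomT_subset_plaqsInside {M₁ : ℕ} (hM2 : 2 ≤ M₁) {Z : Set (Site P 0)} {J : ℕ}
    (hdiv : side P.L M₁ J ∣ P.sitesPerDir 0) {j : ℕ} (hj1 : 1 ≤ j) (hjJ : j ≤ J) :
    plaqsOf (pts j (maxDomT M₁ Z j)) ⊆ plaqsInside (pts j Z) := by
  intro p hp'
  have hM : 1 ≤ M₁ := le_trans (by norm_num) hM2
  obtain ⟨n, rfl⟩ : ∃ n, j = n + 1 := ⟨j - 1, by omega⟩
  -- the four centres on the cover
  set t : ℤ := ((P.L ^ (n + 1) : ℕ) : ℤ) with ht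
  have ht0 : 0 ≤ t := by rw [ht]; exact_mod_cast Nat.zero_le _
  set x : Pt P.d := lift P (embIter (n + 1) p.src) with hxdef
  let q : ℤ → ℤ → Pt P.d := fun a b => x + Pi.single p.μ a + Pi.single p.ν b
  have hq00 : cover P (q 0 0) = embIter (n + 1) p.src := by
    show cover P (x + Pi.single p.μ 0 + Pi.single p.ν 0) = _
    rw [Pi.single_zero, Pi.single_zero, add_zero, add_zero, hxdef, cover_lift]
  have hqt0 : cover P (q t 0) = embIter (n + 1) (p.src.shift p.μ) := by
    show cover P (x + Pi.single p.μ t + Pi.single p.ν 0) = _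
    rw [Pi.single_zero, add_zero, ht, cover_add_single_pow (n + 1) (by rw [hxdef, cover_lift]) p.μ]
  have hq0t : cover P (q 0 t) = embIter (n + 1) (p.src.shift p.ν) := by
    show cover P (x + Pi.single p.μ 0 + Pi.single p.ν t) = _
    rw [Pi.single_zero, add_zero, ht, cover_add_single_pow (n + 1) (by rw [hxdef, cover_lift]) p.ν]
  have hqtt : cover P (q t t) = embIter (n + 1) ((p.src.shift p.μ).shift p.ν) := by
    show cover P (x + Pi.single p.μ t + Pi.single p.ν t) = _
    rw [ht, cover_add_single_pow (n + 1) _ p.ν]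
    rw [cover_add_single_pow (n + 1) (by rw [hxdef, cover_lift]) p.μ]
  -- one corner lies in `Ω_{n+1}(Z)`
  have hne : p.μ ≠ p.ν := ne_of_lt p.hμν
  have h0 : ∃ a b, (a = 0 ∨ a = t) ∧ (b = 0 ∨ b = t) ∧ cover P (q a b) ∈ maxDomT M₁ Z (n + 1) := by
    rcases hp' with h | h | h | h
    · exact ⟨0, 0, Or.inl rfl, Or.inl rfl, by rw [hq00]; exact h⟩
    · exact ⟨t, 0, Or.inr rfl, Or.inl rfl, by rw [hqt0]; exact h⟩
    · exact ⟨0, t, Or.inl rfl, Or.inr rfl, by rw [hq0t]; exact h⟩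
    · exact ⟨t, t, Or.inr rfl, Or.inr rfl, by rw [hqtt]; exact h⟩
  obtain ⟨a₀, b₀, ha₀, hb₀, hmem⟩ := h0
  -- every corner is within `LʲM₁ − 1` of it, hence in `Ω_n(Z) ⊆ Z`
  have hrad : t ≤ (side P.L M₁ (n + 1) : ℤ) - 1 := by
    have h1 : (side P.L M₁ (n + 1) : ℤ) = t * M₁ := by rw [ht]; simp [side, Nat.cast_mul, Nat.cast_pow]
    have h2 : (2 : ℤ) ≤ M₁ := by exact_mod_cast hM2
    have h3 : 1 ≤ t := by rw [ht]; exact_mod_cast Nat.one_le_pow _ _ P.L_pos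
    nlinarith
  have H : ∀ a b, (a = 0 ∨ a = t) → (b = 0 ∨ b = t) → cover P (q a b) ∈ Z := fun a b ha hb =>
    maxDomT_subset hM Z n (dist_maxDomT hM hdiv hjJ hmem ((within_corner x hne ht0 ha₀ hb₀ ha hb).mono hrad))
  refine ⟨?_, ?_, ?_, ?_⟩
  · rw [mem_pts, ← hq00]; exact H 0 0 (Or.inl rfl) (Or.inl rfl)
  · rw [mem_pts, ← hqt0]; exact H t 0 (Or.inr rfl) (Or.inl rfl)
  · rw [mem_pts, ← hq0t]; exact H 0 t (Or.inl rfl) (Or.inr rfl)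
  · rw [mem_pts, ← hqtt]; exact H t t (Or.inr rfl) (Or.inr rfl)

end ZRangesStrong


/-! ## §6 The near-value letter (Vn) at print's (1.74) object from the CLOSED general-sequence [15] letter -/

section AtZSequenceGeneral

open Classical
open B14DomainGeom (IsUnionOfCubes)
open B15Eq112TorusCover (cover)
open B14.Eq213MaximalDomains (side)
open B14.Eq213DetSet B15Sect1Instances B16Sect1Wilson B15Prop1GradientFromNearValue B15Prop1GradientFromNearValueAtCoPRecord
open B15Prop1AtZSequenceRecord
open T4CubeChartGnomonic (SU2)
open B15Extension193 (extend)
open B15ShellGauge193 (shellGauge)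
open B15ShellGauge193Local (dist1_plaqHol_extend_shellGauge_le)
open T4AxialGaugeSmallField (castSite boxPlaqs)
open T4Continuum

/-- ★★★ **THE NEAR-VALUE LETTER (Vn) AT PRINT'S (1.74) OBJECT FROM [15] THEOREM 1 (R) IN CLOSED GENERAL-SEQUENCE FORM** — g11's
`nearValue_letter_of_thm1AtZSeq_geom` with the per-instance letters `h15Z i` REPLACED by ONE instance-independent letter `h15D`: the text of NODE 00's
`Node00.VariationalThm1RegSepTop7M F 2 (fun ν K Ω => Node00.suppDomOfRecord F ν K Ω) B₃ a₀ a₁` after its sequence binder, the binder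
`(M g) (s : Node00.SeqOfRecord F ν M g K k)` generalised to `(D) (s : B14.Eq218Concrete.Seq D k)` with print's cube letter [15] (1) «Ω_j a union of blocks of size
M₁Lʲη» on `s.Ω` (cover reading), at the consumer's numerics `ν` and torus `Kt` (NODE 00's own «TODO(general form)»; a hypothesis binder, no `def`), and with
(Gᵃ) `hZblk` unchanged.  PROOF: §3 packages `Z`'s maximal
sequence as a separated index `s` with `s.Ω j = Ω_j(Z)` on `1 ≤ j ≤ k`; g11's (7)-transfer `dataSmall7PTop_avgFamily_qsstarGIter0` gives print's (7) for the datum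
`M˙(Q_k^{s*}Ṽ_k)` ALONG `s.Ω` (level-`0` range = that of `maxDomT ν.M₁ Z` by §1, inside `Z` by g11's `printedPlaqsTop_maxDomT_subset_plaqsInside`; level `j ≥ 1`
inside `Z^{(j)}` by §5); the (1.74) class and determining set at `maxDomT ν.M₁ Z` ARE those at `s.Ω` (§1 `regMSCoPOfRecord_congr`, `genSet_congr`); `h15D` at
`(k, D, s)` gives (8) at scale `1` on `plaqsOf (Ω₁(Z))`, summed by `nearValue_le_of_plaqSmallOn`; off the solvable set the near value is `0`.
[cite: Balaban1989LargeFieldI, (1.74) p.192, p.193 L14–20; Balaban1985Variational, (1) p.277, (2),(6),(7) p.278, Thm 1 (8) p.279; Balaban1988Convergent, (2.1) p.254,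
p.255, (2.12)–(2.13) pp.256–257, (2.16), (2.18) p.257; Balaban1985RegularSpaces, (1.3)–(1.6) p.77] -/
theorem nearValue_letter_of_thm1General {F : T4Family} (ν : Node00.Stage7Numerics) (Kt : ℕ) (hd3 : 3 ≤ (F.P Kt).d) {ι : Type}
    (Z Λ : ι → Set (Site (F.P Kt) 0)) (k : ι → ℕ) (hk0 : ∀ i, 0 < k i) (hk : ∀ i, k i ≤ (F.P Kt).m + (F.P Kt).K)
    (eR : ι → ℝ)
    (lo hi : ι → Fin (F.P Kt).d → ℤ) (n : ι → ℕ) (hn : ∀ i κ, hi i κ ≤ lo i κ + n i)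
    (hbox : ∀ i, pts (k i) (Λ i) = (castSite '' Set.Icc (lo i) (hi i) : Set (Site (F.P Kt) (k i))))
    (hZ : ∀ i, (boxPlaqs (lo i - 1) (hi i + 1) : Set (Plaq (F.P Kt) (k i))) ⊆ plaqsInside (pts (k i) (Z i)))
    (hN5 : ∀ i κ, ((hi i κ - lo i κ + 1).toNat : ℤ) + 5 < (F.P Kt).sitesPerDir (k i))
    (ext : ∀ i, GaugeField (F.P Kt) (k i) SU2 → GaugeField (F.P Kt) (k i) SU2)
    (hext : ∀ i Vk, ext i Vk = extend (pts (k i) (Λ i)) (shellGauge Vk (lo i) (hi i)) Vk)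
    (hlohi : ∀ i, lo i ≤ hi i)
    -- (Gᵃ) geometry of `Z`: a union of `k`-blocks (print's `Z` is a union of `M`-cubes of `T₁^{(k)}`; §4 derives it from the cube letter on the cover)
    (hZblk : ∀ i, IsBlockUnion (k i) (Z i))
    -- print's `M₁ ≥ 2` and the torus divisibility `L^{k}M₁ ∣ 2L^{m+K}` of the `LʲM₁`-cube partitions
    (hM2 : 2 ≤ ν.M₁) (hdiv : ∀ i, side (F.P Kt).L ν.M₁ (k i) ∣ (F.P Kt).sitesPerDir 0)
    -- bookkeeping constants
    {cE B₃ a₀ a₁ cA : ℝ} (hcE0 : 0 ≤ cE) (hcE : ∀ i, 12 * ((F.P Kt).d : ℝ) * ((n i : ℝ) + 2) ^ 2 ≤ cE) (hB₃ : 0 ≤ B₃)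
    (heRa : ∀ i, (cE + 1) * eR i ≤ a₁ ∧ B₃ * ((cE + 1) * eR i) ≤ ν.εreg) (ha₀ : ν.εreg ≤ a₀)
    (hcA : 1 / 2 * (B₃ * (cE + 1) * (F.P Kt).eta 1 ^ 2) ^ 2 * (Fintype.card (Plaq (F.P Kt) 0) : ℝ) ≤ cA)
    -- [15] THEOREM 1 (R), CLOSED GENERAL-SEQUENCE FORM at the numerics `ν` and torus `Kt`: the body of `Node00.VariationalThm1RegSepTop7M F 2 Sup B₃ a₀ a₁`,
    -- `Sup := suppDomOfRecord`, with the binder `(M g) (s : SeqOfRecord F ν M g K k)` generalised to `(D) (s : Seq D k)` + print's cube letter [15] (1)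
    (h15D : ∀ (k' : ℕ) (D : ℕ → Set (Set (Site (F.P Kt) 0))) (s : B14.Eq218Concrete.Seq D k'),
      (∀ j, 1 ≤ j → j ≤ k' → IsUnionOfCubes (side (F.P Kt).L ν.M₁ j) (cover (F.P Kt) ⁻¹' s.Ω j)) →
      Node00.Sect2.SeqSeparated ν.M₁ s → 0 < ν.M₁ →
      ∀ (ε₀ : ℝ) (δ : ℕ → ℝ), (∀ j, j ≤ k' → 0 < δ j ∧ δ j ≤ a₁ ∧ B₃ * δ j ≤ ε₀) → (∀ j, j < k' → δ j ≤ 2 * δ (j + 1)) →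
      (∀ j, j < k' → δ (j + 1) ≤ 2 * δ j) → ε₀ ≤ a₀ →
      ∀ W : MSField (F.P Kt) SU2,
        Node00.Sect2.DataSmall7PTop (Node00.avOfRecord F 2 Kt) s.Ω (Node00.suppDomOfRecord F ν Kt s.Ω) k' δ W →
        ∀ U₀ : GaugeField (F.P Kt) 0 SU2, IsMinimizer (Node00.avOfRecord F 2 Kt)
            {U | (∀ j, j ≤ k' → PlaqSmallOn (Node00.Sect2.omegaPlaqsTop s.Ω (Node00.suppDomOfRecord F ν Kt s.Ω) j)
                (ε₀ * (F.P Kt).eta j ^ 2) U) ∧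
              Node00.Sect2.CoDivClassOnTop s.Ω (Node00.suppDomOfRecord F ν Kt s.Ω) k' ε₀ U}
            (genSet s.Ω k') W U₀ →
          (∀ j, j ≤ k' → PlaqSmallOn (Node00.Sect2.omegaPlaqsTop s.Ω (Node00.suppDomOfRecord F ν Kt s.Ω) j)
              (B₃ * δ j * (F.P Kt).eta j ^ 2) U₀) ∧
            ∀ j, j ≤ k' → Node00.Sect2.CoDivSmallOn (Node00.Sect2.omegaBondsTop s.Ω (Node00.suppDomOfRecord F ν Kt s.Ω) j)
              (B₃ * δ j * (F.P Kt).eta j ^ 3) U₀)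
    : ∀ i ε Vk, 0 < ε → ε ≤ eR i → PlaqSmallOn (plaqsInside (pts (k i) (Z i ∩ (Λ i)ᶜ))) ε Vk →
      wilsonLoc ((plaqsOf (maxDomT ν.M₁ (Z i) 1)).indicator fun _ => (1 : ℝ))
        (bgKZstd (Node00.bgMSCoPOfRecord F 2 ν Kt (k i) (maxDomT ν.M₁ (Z i))) ν.M₁ (Z i) (k i) (ext i Vk)) ≤ cA * ε ^ 2 := by
  intro i ε Vk hε hεR hreg
  have hd : 2 ≤ (F.P Kt).d := by omega
  have hM : 1 ≤ ν.M₁ := le_trans one_le_two hM2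
  have hki : 1 ≤ k i := hk0 i
  -- `Z`'s maximal sequence as a separated (2.18) index, with print's cube letters
  obtain ⟨s, hsΩ, -, hscube, hsep⟩ := exists_seq_maxDomT hM (Z i) (hdiv i)
  have hw1 : s.Ω 1 = maxDomT ν.M₁ (Z i) 1 := hsΩ 1 le_rfl hki
  -- (a) the p. 193 extension is `(cE+1)ε`-small on the `k`-plaquettes inside `Z`
  have hN3 : ∀ κ, hi i κ - lo i κ + 3 < ((F.P Kt).sitesPerDir (k i) : ℤ) := fun κ => by
    have h5 := hN5 i κ
    have hle : lo i κ ≤ hi i κ := hlohi i κ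
    rw [Int.toNat_of_nonneg (by linarith)] at h5
    linarith
  have hδ₀ : 0 < (cE + 1) * ε := by positivity
  have hV : PlaqSmallOn (plaqsInside (pts (k i) (Z i))) ((cE + 1) * ε) (ext i Vk) := by
    intro p hp
    rw [hext]
    have h := (dist1_plaqHol_extend_shellGauge_le hd3 (hlohi i) (hn i) hN3 (hbox i) (hZ i) hε hreg).1 p hp
    calc dist1 (plaqHol (extend (pts (k i) (Λ i)) (shellGauge Vk (lo i) (hi i)) Vk) p)
        ≤ 12 * (F.P Kt).d * (n i + 2) ^ 2 * ε := h
      _ ≤ cE * ε := mul_le_mul_of_nonneg_right (hcE i) hε.le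
      _ < (cE + 1) * ε := by nlinarith
  -- (b) print's (7) for the datum ALONG THE INDEX `s.Ω`
  have h0 : Node00.Sect2.printedPlaqsTop s.Ω (Node00.suppDomOfRecord F ν Kt s.Ω) (k i) ⊆ plaqsInside (Z i) := by
    rw [printedPlaqsTop_congr hki hsΩ, Node00.suppDomOfRecord_congr (F := F) ν Kt hw1]
    exact printedPlaqsTop_maxDomT_subset_plaqsInside hM (hdiv i) hki (k i)
  have hsucc : ∀ m, m + 1 ≤ k i → Node00.Sect2.printedPlaqs s.Ω (k i) (m + 1) ⊆ plaqsInside (pts (m + 1) (Z i)) := by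
    intro m hm
    refine (Node00.Sect2.printedPlaqs_subset_plaqsOf _ _ _).trans ?_
    refine (plaqsOf_mono (genSet_subset_pts_of_one_le s.Ω (k i) (Nat.succ_pos m))).trans ?_
    rw [hsΩ (m + 1) (Nat.succ_pos m) hm]
    exact plaqsOf_pts_maxDomT_subset_plaqsInside hM2 (hdiv i) (Nat.succ_pos m) hm
  have h7 : Node00.Sect2.DataSmall7PTop (Node00.avOfRecord F 2 Kt) s.Ω (Node00.suppDomOfRecord F ν Kt s.Ω) (k i)
      (fun _ => (cE + 1) * ε) (avgFamily (Node00.avOfRecord F 2 Kt) (qsstarGIter0 (k i) (ext i Vk))) :=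
    dataSmall7PTop_avgFamily_qsstarGIter0 hd ExpMeanLog.expMeanLogSU T3DescentFibreTower.expMeanLogSU_E_one rfl (hk i)
      s.Ω _ (Z i) (hZblk i) h0 hsucc (fun _ _ => hδ₀) (ext i Vk) (fun _ _ => hV)
  -- numerics of the thresholds
  have hnum : ∀ j, j ≤ k i → 0 < (cE + 1) * ε ∧ (cE + 1) * ε ≤ a₁ ∧ B₃ * ((cE + 1) * ε) ≤ ν.εreg := fun j _ => by
    obtain ⟨ha, hb⟩ := heRa i
    have h1 : (cE + 1) * ε ≤ (cE + 1) * eR i := mul_le_mul_of_nonneg_left hεR (by linarith)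
    exact ⟨hδ₀, h1.trans ha, (mul_le_mul_of_nonneg_left h1 hB₃).trans hb⟩
  -- (c) the (1.74) class and determining set at `maxDomT ν.M₁ Z` ARE those at the index `s`
  have hreg : Node00.regMSCoPOfRecord F 2 ν Kt (k i) (maxDomT ν.M₁ (Z i)) = Node00.regMSCoPOfRecord F 2 ν Kt (k i) s.Ω :=
    (regMSCoPOfRecord_congr F 2 ν Kt hki hsΩ).symm
  have hB : Bj ν.M₁ (Z i) (k i) = genSet s.Ω (k i) := (genSet_congr hki hsΩ).symm
  rw [bgKZstd_apply, Node00.bgMSCoPOfRecord_U, hreg, hB]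
  by_cases hsol : ∃ U₀, IsMinimizer (Node00.avOfRecord F 2 Kt) (Node00.regMSCoPOfRecord F 2 ν Kt (k i) s.Ω)
      (genSet s.Ω (k i)) (avgFamily (Node00.avOfRecord F 2 Kt) (qsstarGIter0 (k i) (ext i Vk))) U₀
  · have hmin := Node00.isMinimizer_UminOfRecord _ _ hsol
    have h8 := h15D (k i) _ s hscube hsep hM ν.εreg (fun _ => (cE + 1) * ε) hnum (fun _ _ => by linarith) (fun _ _ => by linarith)
      ha₀ _ h7 _ hmin
    have h81 : PlaqSmallOn (plaqsOf (maxDomT ν.M₁ (Z i) 1)) (B₃ * ((cE + 1) * ε) * (F.P Kt).eta 1 ^ 2)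
        (Node00.UminOfRecord (Node00.avOfRecord F 2 Kt) (Node00.regMSCoPOfRecord F 2 ν Kt (k i) s.Ω)
          (genSet s.Ω (k i)) (avgFamily (Node00.avOfRecord F 2 Kt) (qsstarGIter0 (k i) (ext i Vk)))) := by
      have h := h8.1 1 hki
      rwa [Node00.Sect2.omegaPlaqsTop_of_ne_zero _ _ one_ne_zero, Node00.omegaPlaqs_of_ne_zero _ one_ne_zero, hw1] at h
    have hδ1 : 0 ≤ B₃ * ((cE + 1) * ε) * (F.P Kt).eta 1 ^ 2 := by positivity
    refine (nearValue_le_of_plaqSmallOn (maxDomT ν.M₁ (Z i) 1) hδ1 _ h81).trans ?_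
    calc _ ≤ 1 / 2 * (B₃ * ((cE + 1) * ε) * (F.P Kt).eta 1 ^ 2) ^ 2 * (Fintype.card (Plaq (F.P Kt) 0) : ℝ) := by
          gcongr
          exact_mod_cast (Finset.card_filter_le _ _).trans (le_of_eq Finset.card_univ)
      _ = 1 / 2 * (B₃ * (cE + 1) * (F.P Kt).eta 1 ^ 2) ^ 2 * (Fintype.card (Plaq (F.P Kt) 0) : ℝ) * ε ^ 2 := by ring
      _ ≤ cA * ε ^ 2 := mul_le_mul_of_nonneg_right hcA (sq_nonneg ε)
  · rw [Node00.UminOfRecord_of_not _ _ hsol, wilsonLoc_one_cfg]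
    have h0' : (0 : ℝ) ≤ 1 / 2 * (B₃ * (cE + 1) * (F.P Kt).eta 1 ^ 2) ^ 2 * (Fintype.card (Plaq (F.P Kt) 0) : ℝ) := by positivity
    nlinarith [sq_nonneg ε]

end AtZSequenceGeneral

/-! ## §7 Proposition 1 [IV] at print's (1.74) object with the [15] letter in closed general-sequence form -/

section EndpointGeneral

open Classical
open Metric
open scoped BigOperators RealInnerProductSpace InnerProductSpace
open B14DomainGeom (IsUnionOfCubes)
open B15Eq112TorusCover (cover)
open B14.Eq213MaximalDomains (side)
open B14.Eq213DetSet B15Sect1Instances B16Sect1Wilson B16Sect1Backgrounds B15Prop1GradientFromNearValue B15Prop1GradientFromNearValueAtCoPRecord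
open B15Prop1AtZSequenceRecord B15Prop1SliceTaylorCalculus B15Prop1IntrinsicOfFun
open B15Prop1AnalyticExtClause (cplxVec cplxSlice anExt)
open B15Prop1ChartCalculusSU2 (E3)
open T4CubeChartGnomonic (SU2)
open B15Prop1ChartSU2 (su2Chart)
open B15Prop1SliceCoordinates (GaugeSlice ιA freeBonds)
open T4AxialGaugeSmallField (castSite boxPlaqs)
open B6BondElimination (unitVec)
open B16Eq18Proof (box)
open B15Extension193 (extend)
open B15ShellGauge193 (shellGauge)
open B15ShellGauge193Local (dist1_plaqHol_extend_shellGauge_le)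
open B5Bounds167Lattice (formDk ofRealCfg)
open T4Continuum

/-- ★★★ **PROPOSITION 1 [IV] WITH ITS ANALYTIC-EXTENSION CLAUSE AT PRINT'S (1.74) OBJECT, THE [15] LETTER IN CLOSED GENERAL-SEQUENCE FORM** — g11's
`…_atZSeqCoPRecord_ofThm1AtZSeq_geom` with the per-instance letters `h15Z i` REPLACED by ONE closed letter `h15D` (the text of
`Node00.VariationalThm1RegSepTop7M F 2 (fun ν K Ω => Node00.suppDomOfRecord F ν K Ω) B₃ a₀ a₁'` after its sequence binder, generalised to
`(D) (s : B14.Eq218Concrete.Seq D k)` + print's cube letter [15] (1), at the numerics `ν` and torus `Kt`); every other binder unchanged.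
WHAT A CONSUMER SUPPLIES per instance: (J1) `hGj`, (L2) `hlead` + `hsm`∕`hγle` (NODE 00's), `hfar`, (Gᵃ) `hZblk`, `0 < k i ≤ m + K`, structure, numerics
(`hcE`∕`heRa`∕`hB₃`∕`hcA`∕`ha₀`∕`hcJ'`), `hM2`, `hdiv`, `hcl := Subsingleton.elim _ _`; and ONCE per run: `h15D`.
[cite: Balaban1989LargeFieldI, (1.74) p.192, Prop. 1 (1.77)–(1.78) p.194 (incl. the last clause), p.193 L14–20; Balaban1988Convergent, (2.1) p.254, p.255, (2.12)–(2.13)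
pp.256–257, (2.16), (2.18) p.257; Balaban1985Variational, (1) p.277, (2),(5),(6),(7) p.278, Thm 1 (8) p.279, Prop. 9 p.309; Balaban1989LargeFieldII, (1.7)–(1.9) p.358, (1.11)
p.358, (1.12)–(1.13) p.359] -/
theorem exists_domain_prop1Printed_lfVarOn_std_su2_box_intrinsic_analytic_atZSeqCoPRecord_ofThm1General {F : T4Family}
    (ν : Node00.Stage7Numerics) (Kt : ℕ) (hd3 : 3 ≤ (F.P Kt).d) (h0 : 0 < (F.P Kt).d) {ι : Type}
    [hdec : ∀ j, DecidableEq (PBond (F.P Kt) j)] (hcl : hdec = fun _ a b => Classical.propDecidable (a = b))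
    (Z Λ : ι → Set (Site (F.P Kt) 0)) (k : ι → ℕ) (M : ι → ℝ) (hk0 : ∀ i, 0 < k i) (hk : ∀ i, k i ≤ (F.P Kt).m + (F.P Kt).K)
    (eR : ι → ℝ) (heR : ∀ i, 0 < eR i)
    (T : ∀ i, Finset (PBond (F.P Kt) (k i)))
    (lo hi : ι → Fin (F.P Kt).d → ℤ) (n : ι → ℕ) (hn : ∀ i κ, hi i κ ≤ lo i κ + n i) (hN : ∀ i, n i + 2 < (F.P Kt).sitesPerDir (k i))
    (hbox : ∀ i, pts (k i) (Λ i) = (castSite '' Set.Icc (lo i) (hi i) : Set (Site (F.P Kt) (k i))))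
    (hZ : ∀ i, (boxPlaqs (lo i - 1) (hi i + 1) : Set (Plaq (F.P Kt) (k i))) ⊆ plaqsInside (pts (k i) (Z i)))
    (hTG0 : ∀ i, T i = (box (fun κ => (hi i κ - lo i κ + 1).toNat) (lo i)).image fun x =>
      (⟨castSite (x - unitVec ⟨0, h0⟩), ⟨0, h0⟩⟩ : PBond (F.P Kt) (k i)))
    (hN5 : ∀ i κ, ((hi i κ - lo i κ + 1).toNat : ℤ) + 5 < (F.P Kt).sitesPerDir (k i))
    (K : ι → ℕ) (hK1 : ∀ i, 1 ≤ K i) (hKn : ∀ i κ, (hi i κ - lo i κ + 1).toNat ≤ K i)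
    (ext : ∀ i, GaugeField (F.P Kt) (k i) SU2 → GaugeField (F.P Kt) (k i) SU2)
    (hext : ∀ i Vk, ext i Vk = extend (pts (k i) (Λ i)) (shellGauge Vk (lo i) (hi i)) Vk)
    (hlohi : ∀ i, lo i ≤ hi i)
    {γ cJ bx : ℝ} (hγ : 0 < γ) (hcJ : 0 ≤ cJ) (hbx : 0 ≤ bx)
    (hbxM : ∀ i, 12 * ((F.P Kt).d : ℝ) * ((n i : ℝ) + 2) ^ 2 ≤ bx * (M i) ^ 2)
    {Cerr R 𝓐 : ι → ℝ} (hM : ∀ i, 1 ≤ (M i)) (hR : ∀ i, 0 < R i) (h𝓐 : ∀ i, 0 ≤ 𝓐 i)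
    (n' : ι → ℕ) (hn' : ∀ i, 1 ≤ n' i)
    -- (J1) the JOINT holomorphic extension of print's function in the datum perturbation and the field
    (hGj : ∀ i Vk, PlaqSmallOn (plaqsInside (pts (k i) (Z i ∩ (Λ i)ᶜ))) (eR i) Vk →
      ∃ 𝒢 : VecField (F.P Kt) (k i) (EuclideanSpace ℂ (Fin 3)) × VecField (F.P Kt) (k i) (EuclideanSpace ℂ (Fin 3)) → ℂ,
        DifferentiableOn ℂ 𝒢 (ball 0 (R i)) ∧
        (∀ z ∈ ball (0 : VecField (F.P Kt) (k i) (EuclideanSpace ℂ (Fin 3)) × VecField (F.P Kt) (k i) (EuclideanSpace ℂ (Fin 3))) (R i), ‖𝒢 z‖ ≤ 𝓐 i) ∧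
        ∀ p B' : VecField (F.P Kt) (k i) E3, ‖p‖ < R i → ‖B'‖ < R i →
          𝒢 (cplxVec p, cplxVec B') =
            ((fun177std (Node00.bgMSCoPOfRecord F 2 ν Kt (k i) (maxDomT ν.M₁ (Z i))) ν.M₁ (Z i) (k i)
              (expMul su2Chart B' (ext i (expMul su2Chart p Vk))) : ℝ) : ℂ))
    -- (L2) (1.7)–(1.9) p.358 for the Hessian of the slice function at `0`
    (hlead : ∀ i Vk, PlaqSmallOn (plaqsInside (pts (k i) (Z i ∩ (Λ i)ᶜ))) (eR i) Vk →
      ∀ X : GaugeSlice (pts (k i) (Λ i)) (T i) E3,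
      |⟪X, (fderiv ℝ (rGrad (pts (k i) (Λ i)) (T i)
              (sliceFn (pts (k i) (Λ i)) (T i)
                (fun177std (Node00.bgMSCoPOfRecord F 2 ν Kt (k i) (maxDomT ν.M₁ (Z i))) ν.M₁ (Z i) (k i)) (ext i Vk))) 0) X⟫ -
          ∑ a : Fin 3, formDk (n' i) (fun _ : Fin (F.P Kt).d => (F.P Kt).sitesPerDir (k i))
            (ofRealCfg (fun _ : Fin (F.P Kt).d => (F.P Kt).sitesPerDir (k i)) fun j =>
              ιA (pts (k i) (Λ i)) (T i) X ⟨j.1, j.2⟩ a)| ≤ Cerr i * ‖X‖ ^ 2)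
    (hsm : ∀ i, Cerr i ≤ (4 / Real.pi ^ 2) ^ ((F.P Kt).d + 2) / (2 * (3 * (K i : ℝ) ^ 2 + 2 * (K i : ℝ) ^ 4)))
    (hγle : ∀ i, γ / (M i) ^ 5 ≤ (4 / Real.pi ^ 2) ^ ((F.P Kt).d + 2) / (2 * (3 * (K i : ℝ) ^ 2 + 2 * (K i : ℝ) ^ 4)))
    -- the geometric letter: the k-blocks over the bonds meeting `Λ^{(k)}` lie inside `Ω₁(Z)` (print: `Λ` deep inside `Z`)
    (hfar : ∀ i (b : PBond (F.P Kt) 0), b.src ∉ maxDomT ν.M₁ (Z i) 1 →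
      (⟨blockIter (k i) b.src, b.dir⟩ : PBond (F.P Kt) (k i)) ∉ bondsOf (pts (k i) (Λ i)))
    -- (Gᵃ) geometry of `Z`: a union of `k`-blocks (print's `Z` is a union of `M`-cubes of `T₁^{(k)}`; §4 derives it from the cube letter on the cover)
    (hZblk : ∀ i, IsBlockUnion (k i) (Z i))
    -- print's `M₁ ≥ 2` and the torus divisibility `L^{k}M₁ ∣ 2L^{m+K}` of the `LʲM₁`-cube partitions
    (hM2 : 2 ≤ ν.M₁) (hdiv : ∀ i, side (F.P Kt).L ν.M₁ (k i) ∣ (F.P Kt).sitesPerDir 0)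
    -- bookkeeping constants
    {cE B₃ a₀ a₁' cA : ℝ} (hcE0 : 0 ≤ cE) (hcE : ∀ i, 12 * ((F.P Kt).d : ℝ) * ((n i : ℝ) + 2) ^ 2 ≤ cE) (hB₃ : 0 ≤ B₃)
    (heRa : ∀ i, (cE + 1) * eR i ≤ a₁' ∧ B₃ * ((cE + 1) * eR i) ≤ ν.εreg) (ha₀ : ν.εreg ≤ a₀)
    (hcA : 1 / 2 * (B₃ * (cE + 1) * (F.P Kt).eta 1 ^ 2) ^ 2 * (Fintype.card (Plaq (F.P Kt) 0) : ℝ) ≤ cA)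
    -- [15] THEOREM 1 (R), CLOSED GENERAL-SEQUENCE FORM at `ν`, `Kt` (see `nearValue_letter_of_thm1General`)
    (h15D : ∀ (k' : ℕ) (D : ℕ → Set (Set (Site (F.P Kt) 0))) (s : B14.Eq218Concrete.Seq D k'),
      (∀ j, 1 ≤ j → j ≤ k' → IsUnionOfCubes (side (F.P Kt).L ν.M₁ j) (cover (F.P Kt) ⁻¹' s.Ω j)) →
      Node00.Sect2.SeqSeparated ν.M₁ s → 0 < ν.M₁ →
      ∀ (ε₀ : ℝ) (δ : ℕ → ℝ), (∀ j, j ≤ k' → 0 < δ j ∧ δ j ≤ a₁' ∧ B₃ * δ j ≤ ε₀) → (∀ j, j < k' → δ j ≤ 2 * δ (j + 1)) →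
      (∀ j, j < k' → δ (j + 1) ≤ 2 * δ j) → ε₀ ≤ a₀ →
      ∀ W : MSField (F.P Kt) SU2,
        Node00.Sect2.DataSmall7PTop (Node00.avOfRecord F 2 Kt) s.Ω (Node00.suppDomOfRecord F ν Kt s.Ω) k' δ W →
        ∀ U₀ : GaugeField (F.P Kt) 0 SU2, IsMinimizer (Node00.avOfRecord F 2 Kt)
            {U | (∀ j, j ≤ k' → PlaqSmallOn (Node00.Sect2.omegaPlaqsTop s.Ω (Node00.suppDomOfRecord F ν Kt s.Ω) j)
                (ε₀ * (F.P Kt).eta j ^ 2) U) ∧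
              Node00.Sect2.CoDivClassOnTop s.Ω (Node00.suppDomOfRecord F ν Kt s.Ω) k' ε₀ U}
            (genSet s.Ω k') W U₀ →
          (∀ j, j ≤ k' → PlaqSmallOn (Node00.Sect2.omegaPlaqsTop s.Ω (Node00.suppDomOfRecord F ν Kt s.Ω) j)
              (B₃ * δ j * (F.P Kt).eta j ^ 2) U₀) ∧
            ∀ j, j ≤ k' → Node00.Sect2.CoDivSmallOn (Node00.Sect2.omegaBondsTop s.Ω (Node00.suppDomOfRecord F ν Kt s.Ω) j)
              (B₃ * δ j * (F.P Kt).eta j ^ 3) U₀)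
    (hcJ' : ∀ i, 2 * cA * eR i / R i + 4 * 𝓐 i / (R i * eR i) ≤ cJ)
    : ∃ a₁ : ι → ℝ, (∀ i, 0 < a₁ i) ∧
      B15.Prop1Printed (lfVarOn su2Chart fun i =>
        InstOn.std (Node00.bgMSCoPOfRecord F 2 ν Kt (k i) (maxDomT ν.M₁ (Z i))) ν.M₁ (Z i) (Λ i) (k i) (M i) (a₁ i)
          (anExt (pts (k i) (Λ i)) (T i)
            (fun177std (Node00.bgMSCoPOfRecord F 2 ν Kt (k i) (maxDomT ν.M₁ (Z i))) ν.M₁ (Z i) (k i)) (ext i)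
            (min (1 / 2) (min (R i / 8) (γ / (M i) ^ 5 * (R i / 2) ^ 2 / (48 * (4 * 𝓐 i / R i + 1))))))) :=
  exists_domain_prop1Printed_lfVarOn_std_su2_box_intrinsic_analytic_atZSeqCoPRecord_ofNearValue ν Kt hd3 h0 hcl Z Λ k M hk0 hk eR heR
    T lo hi n hn hN hbox hZ hTG0 hN5 K hK1 hKn ext hext hlohi hγ hcJ hbx hbxM hM hR h𝓐 n' hn' hGj hlead hsm hγle hfar
    (nearValue_letter_of_thm1General ν Kt hd3 Z Λ k hk0 hk eR lo hi n hn hbox hZ hN5 ext hext hlohi hZblk hM2 hdiv hcE0 hcE hB₃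
      heRa ha₀ hcA h15D) hcJ'

end EndpointGeneral

/-! ## §8 Non-vacuity of the cube letter at `Z = T_η` -/

section NonVacuity

open B15Eq112TorusCover (cover)
open B14DomainGeom (IsUnionOfCubes)

variable {P : Params}

/-- At `Z = T_η` the cube letter of §4 holds for every side (the whole cover is a union of cubes) — with g11's §7 witnesses, the §6–§7 endpoints stay consumable there.
[cite: Balaban1988Convergent, (2.13) pp.256–257 (bookkeeping)] -/
theorem isUnionOfCubes_preimage_univ (s : ℕ) : IsUnionOfCubes s (cover P ⁻¹' (Set.univ : Set (Site P 0))) :=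
  fun _ _ _ => by simp

end NonVacuity

end Literature.MathematicalPhysics.QuantumFieldTheory.Balaban1983to89.B15Prop1Thm1GeneralFormAtZSequence

end
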